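import Literature.IUT.HodgeTheaters.StableCurveTemperedDataOfSpecialFibreTowerLemmas
import Literature.IUT.HodgeTheaters.TemperedCoveringsProp24InvLimit
import Literature.AnabelianGeometry.SemiGraphs.TemperedCompletionExistence
import Mathlib.Topology.Algebra.ClopenNhdofOne
import HarnessLib

/-!
# [IUTchI] Prop. 2.4 (i) at the genuine 𝔛-data: the kernel of `Ĵ ↠ Π̂_{𝔾_J}` and the input (INV)

Mochizuki, *Inter-universal Teichmüller theory I*, kurims manuscript (May 2020), §2, proof of Prop. 2.4 (i),
p. 50 l. 33 and l. 40–42: "the natural surjection on pro-`Σ̂` completions `Ĵ ↠ Π̂_{𝔾_J}`" and "Since, by allowing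
`J` to vary, `Π^tp_X` (respectively, `Π̂_X`) may be written as an inverse limit of the topological groups
`Π^tp_X/Ker(J ↠ Π^tp_{𝔾_J})` (respectively, `Π̂_X/Ker(Ĵ ↠ Π̂_{𝔾_J})`), we thus conclude that `γ` lies in `Π^tp_X`"
[cite: Mochizuki2012, Prop 2.4(i) p.50] (D-0012 claim key; nothing of the series is asserted here); the
profinite-completion facts are [SemiAnbd] §6 p. 69 [cite: MochizukiSemiAnbd2006, §6 p.69].

PROOF-ONLY companion of `StableCurveTemperedDataOfSpecialFibreTower(Lemmas).lean` (abc-iut-L5-t11; no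
definitions).  For the level data `towerOfSpecialFibreTower` of the genuine 𝔛-data:
* `ker_piHatLevel_eq` — **`Ker(Ĵ_i ∩ Δ_X ↠ Π̂_{𝔾_{J_i}})` IS the closure of `ι(Ker adm_i)`**: the quotient
  `Ĵ_i / closure ι(Ker adm_i)` is ANOTHER profinite completion of `π₁^temp(𝒢_i) = N_i / Ker adm_i` (the chart
  is an open quotient of `N_i`, `Ĵ_i` is the completion of `N_i`), so by uniqueness of profinite completions
  (`IsProfiniteCompletion.nonempty_continuousMulEquiv`) the induced map to `Π̂_{𝔾_{J_i}}` is injective;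
* `map_ker_pihat_eq_closure` — the same kernel read in `Π̂_X`: the closure of `ι(admKer_i)` in `Π_{X_K}`
  ("`Ker(Δ̂_X ↠ Π̂_{𝔾*_J})`", p. 51; = abc-iut-w4-d063's `admKerHat`, stated here unfolded);
* hence the monotonicity input `hmono` of abc-iut-L5-t11's `Prop24Tower.detectsTempered_of_inverseLimit` holds
  when the admissible kernels are determined by the levels (`hNinj : N_j ≤ N_i → admKer_j ≤ admKer_i`), and
  `detectsTempered_ofSpecialFibre` reduces the sub-DAG input (INV) `DetectsTempered` at the genuine datum to the
  TEMPERED COMPLETENESS statement `hlim` ("`Π^tp_X = lim Π^tp_X/Ker(J ↠ Π^tp_{𝔾_J})`", coset form, over the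
  levels below a given one) and `hcof` — compose with `prop24i_ofSpecialFibre_byName` (TowerLemmas) for Prop. 2.4 (i)
  at the genuine datum with (INV) so reduced.
Typed ≠ discharged for `hlim`; nothing here bears on [IUTchIII] Cor. 3.12.
-/

noncomputable section

namespace Literature.IUT.HodgeTheaters

open _root_.Topology
open scoped Pointwise
open Literature.AnabelianGeometry.SemiGraphs Literature.AnabelianGeometry.SemiGraphs.ProfiniteSemiGraph

namespace StableCurveTemperedData

namespace OfSpecialFibre

/-- The quotient of a compact totally disconnected group by a CLOSED normal subgroup is totally
disconnected; private copy of the tree's `QuotientGroup.totallyDisconnectedSpace_of_isClosed`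
(AbsoluteAnabelian/LocalReciprocityCofinal.lean, whose imports are not wanted here). [folklore] -/
private theorem totallyDisconnectedSpace_quotient {A : Type*} [Group A] [TopologicalSpace A]
    [IsTopologicalGroup A] [CompactSpace A] [TotallyDisconnectedSpace A]
    (N : Subgroup A) [N.Normal] (hN : IsClosed (N : Set A)) : TotallyDisconnectedSpace (A ⧸ N) := by
  haveI : TotallySeparatedSpace (A ⧸ N) := by
    rw [totallySeparatedSpace_iff_exists_isClopen]
    intro x y hxy
    obtain ⟨g, rfl⟩ := QuotientGroup.mk_surjective x
    obtain ⟨g', rfl⟩ := QuotientGroup.mk_surjective y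
    set h : A := g⁻¹ * g' with hh
    have hhN : h ∉ N := fun hmem => hxy (QuotientGroup.eq.mpr hmem)
    let O : Set A := (fun k : A => k * h) ⁻¹' (N : Set A)ᶜ
    have hO : IsOpen O := hN.isOpen_compl.preimage (continuous_id.mul continuous_const)
    have h1O : (1 : A) ∈ O := by
      change 1 * h ∈ (N : Set A)ᶜ
      rw [one_mul]; exact hhN
    obtain ⟨K, hK⟩ := ProfiniteGrp.exist_openNormalSubgroup_sub_open_nhds_of_one hO h1O
    let S : Subgroup A := K.toSubgroup ⊔ N
    have hSopen : IsOpen (S : Set A) := Subgroup.isOpen_mono le_sup_left K.isOpen'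
    have hSclosed : IsClosed (S : Set A) := Subgroup.isClosed_of_isOpen _ hSopen
    refine ⟨QuotientGroup.mk '' (g • (S : Set A)), ⟨?_, ?_⟩, ?_, ?_⟩
    · exact QuotientGroup.isClosedMap_coe hN.isCompact _ (hSclosed.smul g)
    · exact QuotientGroup.isOpenMap_coe _ (hSopen.smul g)
    · exact ⟨g, ⟨1, S.one_mem, by simp⟩, rfl⟩
    · rintro ⟨s, ⟨t, ht, rfl⟩, hs⟩
      have hmem : (g • t)⁻¹ * g' ∈ N := QuotientGroup.eq.mp hs
      have ht' : h ∈ (S : Set A) := by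
        have h2 : h = t * ((g • t)⁻¹ * g') := by
          rw [hh, smul_eq_mul, mul_inv_rev]; group
        rw [h2]
        exact S.mul_mem ht (Subgroup.mem_sup_right hmem)
      rw [Subgroup.mul_normal] at ht'
      obtain ⟨k, hk, n, hn, hkn⟩ := ht'
      have hk' : k⁻¹ ∈ O := hK (K.toSubgroup.inv_mem hk)
      apply hk'
      change k⁻¹ * h ∈ (N : Set A)
      rw [← hkn, inv_mul_cancel_left]
      exact hn
  infer_instance

variable {p : ℕ} [Fact p.Prime] (X : TemperedCurve p) (d : X.GroupLevelData)
  (T : SpecialFibreTower X.DeltaTemp)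

include d in
/-- The closure of `ι(Ker adm_i)` in `Ĵ_i ∩ Δ_X` is NORMAL (`Ker adm_i ⊴ N_i`, `ι(N_i)` dense, closures closed).
([IUTchI] Prop 2.4(i) p.50) [claim: Mochizuki2012, status: disputed] -/
theorem closure_map_ker_adm_normal (i : ℕ) :
    ((((T.adm i).toMonoidHom.ker).map (iotaLevel X T i).toMonoidHom).topologicalClosure).Normal := by
  refine ProfiniteCompletionRestrict.normal_of_dense_conj _ (Subgroup.isClosed_topologicalClosure _)
    (iotaLevel_isProfiniteCompletion X d T i).denseRange ?_
  rintro _ ⟨m, rfl⟩ h hh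
  refine ProfiniteCompletionRestrict.conj_mem_topologicalClosure_of_forall _ _ (fun k hk => ?_) h hh
  obtain ⟨n, hn, rfl⟩ := hk
  refine ⟨m * n * m⁻¹, ?_, by simp only [map_mul, map_inv]; rfl⟩
  simp only [SetLike.mem_coe, MonoidHom.mem_ker, map_mul, map_inv] at hn ⊢
  rw [hn, mul_one, mul_inv_cancel]

/-- **`Ker(Ĵ_i ∩ Δ_X ↠ Π̂_{𝔾_{J_i}})` ⊆ closure of `ι(Ker adm_i)`** — the substantive half: the quotient of
`Ĵ_i ∩ Δ_X` by that closure is a profinite completion of `π₁^temp(𝒢_i)`, hence maps ISOMORPHICALLY onto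
`Π̂_{𝔾_{J_i}}` (uniqueness of completions). ([IUTchI] Prop 2.4(i) p.50) [claim: Mochizuki2012, status: disputed] -/
theorem ker_piHatLevel_le_closure (i : ℕ) :
    (piHatLevel X d T i).toMonoidHom.ker ≤
      (((T.adm i).toMonoidHom.ker).map (iotaLevel X T i).toMonoidHom).topologicalClosure := by
  classical
  -- notation-free abbreviations
  have hJ := iotaLevel_isProfiniteCompletion X d T i
  have hG := (TemperedGraphGroupData.exists_completion_of_prop36 (T.Gc i) (T.hyp i).toProp36Hypotheses
    (T.chart i)).choose_spec.choose_spec.1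
  haveI : CompactSpace (levelHat X T i) := hJ.compactSpace
  haveI : TotallyDisconnectedSpace (levelHat X T i) := hJ.totallyDisconnectedSpace
  haveI := hG.t2Space
  haveI hKn : ((((T.adm i).toMonoidHom.ker).map (iotaLevel X T i).toMonoidHom).topologicalClosure).Normal :=
    closure_map_ker_adm_normal X d T i
  have hKcl : IsClosed (((((T.adm i).toMonoidHom.ker).map (iotaLevel X T i).toMonoidHom).topologicalClosure :
      Subgroup (levelHat X T i)) : Set (levelHat X T i)) := Subgroup.isClosed_topologicalClosure _
  haveI : IsClosed (((((T.adm i).toMonoidHom.ker).map (iotaLevel X T i).toMonoidHom).topologicalClosure :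
      Subgroup (levelHat X T i)) : Set (levelHat X T i)) := hKcl
  -- the quotient `Q := Ĵ / K` and `θ := mk ∘ ιJ : N_i → Q`
  haveI hQtd : TotallyDisconnectedSpace ((levelHat X T i) ⧸
      (((T.adm i).toMonoidHom.ker).map (iotaLevel X T i).toMonoidHom).topologicalClosure) :=
    totallyDisconnectedSpace_quotient _ hKcl
  let K : Subgroup (levelHat X T i) :=
    (((T.adm i).toMonoidHom.ker).map (iotaLevel X T i).toMonoidHom).topologicalClosure
  let mk : (levelHat X T i) →* (levelHat X T i) ⧸ K := QuotientGroup.mk' K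
  have hmk_cont : Continuous mk := QuotientGroup.continuous_mk
  let θ : (T.N i) →* (levelHat X T i) ⧸ K := mk.comp (iotaLevel X T i).toMonoidHom
  have hθ_cont : Continuous θ := hmk_cont.comp (iotaLevel X T i).continuous
  have hθ_ker : (T.adm i).toMonoidHom.ker ≤ θ.ker := by
    intro n hn
    rw [MonoidHom.mem_ker]
    change mk (iotaLevel X T i n) = 1
    rw [QuotientGroup.mk'_apply, QuotientGroup.eq_one_iff]
    exact Subgroup.le_topologicalClosure _ ⟨n, hn, rfl⟩
  -- `j : π₁^temp(𝒢_i) → Q`, the lift of `θ` through the open surjection `adm i`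
  let j : (T.chart i).G →* (levelHat X T i) ⧸ K :=
    (T.adm i).toMonoidHom.liftOfSurjective (T.adm_surjective i) ⟨θ, hθ_ker⟩
  have hj_adm : ∀ n : T.N i, j (T.adm i n) = θ n := fun n =>
    (T.adm i).toMonoidHom.liftOfRightInverse_comp_apply _ _ ⟨θ, hθ_ker⟩ n
  have hj_cont : Continuous j := by
    have hq : IsQuotientMap (T.adm i) :=
      (T.isOpenMap_adm i).isQuotientMap (T.adm i).continuous (T.adm_surjective i)
    rw [hq.continuous_iff]
    have : (j : (T.chart i).G → (levelHat X T i) ⧸ K) ∘ (T.adm i) = θ := funext fun n => hj_adm n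
    rw [this]
    exact hθ_cont
  let jc : (T.chart i).G →ₜ* (levelHat X T i) ⧸ K := { toMonoidHom := j, continuous_toFun := hj_cont }
  -- `jc` is a profinite completion of `π₁^temp(𝒢_i)`
  have hjc : IsProfiniteCompletion jc := by
    refine
      { compactSpace := inferInstance
        t2Space := inferInstance
        totallyDisconnectedSpace := hQtd
        denseRange := ?_
        comap_surjective := ?_
        isOpen_comap := fun V => V.toOpenSubgroup.isOpen.preimage hj_cont }
    · -- dense range: `range j = range θ = mk (ιJ(N_i))`
      have hr : Set.range jc = Set.range θ := by
        ext q
        constructor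
        · rintro ⟨g, rfl⟩
          obtain ⟨n, rfl⟩ := T.adm_surjective i g
          exact ⟨n, (hj_adm n).symm⟩
        · rintro ⟨n, rfl⟩
          exact ⟨T.adm i n, hj_adm n⟩
      rw [DenseRange, hr]
      have : (θ : T.N i → (levelHat X T i) ⧸ K) = mk ∘ (iotaLevel X T i) := rfl
      rw [← DenseRange, this]
      exact (QuotientGroup.mk'_surjective K).denseRange.comp hJ.denseRange hmk_cont
    · -- open normal finite-index subgroups of `π₁^temp(𝒢_i)` are cut out by open normal subgroups of `Q`
      intro U' hU'
      haveI := hU'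
      haveI : U'.toSubgroup.Normal := U'.isNormal'
      let U'' : OpenNormalSubgroup (T.N i) :=
        { toSubgroup := U'.toSubgroup.comap (T.adm i).toMonoidHom
          isOpen' := U'.toOpenSubgroup.isOpen.preimage (T.adm i).continuous
          isNormal' := inferInstance }
      have hU''fi : U''.toSubgroup.FiniteIndex := by
        refine ⟨?_⟩
        change (U'.toSubgroup.comap (T.adm i).toMonoidHom).index ≠ 0
        rw [Subgroup.index_comap_of_surjective _ (T.adm_surjective i)]
        exact hU'.index_ne_zero
      obtain ⟨V, hV⟩ := hJ.comap_surjective U'' hU''fi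
      haveI : V.toSubgroup.Normal := V.isNormal'
      have hKV : K ≤ V.toSubgroup := by
        refine Subgroup.topologicalClosure_minimal _ ?_ V.toOpenSubgroup.isClosed
        rintro _ ⟨n, hn, rfl⟩
        have hn' : n ∈ U''.toSubgroup := by
          change n ∈ U'.toSubgroup.comap (T.adm i).toMonoidHom
          rw [Subgroup.mem_comap, (MonoidHom.mem_ker).1 hn]
          exact U'.toSubgroup.one_mem
        rw [hV] at hn'
        exact hn'
      refine ⟨{ toSubgroup := V.toSubgroup.map mk
                isOpen' := QuotientGroup.isOpenMap_coe _ V.toOpenSubgroup.isOpen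
                isNormal' := Subgroup.Normal.map inferInstance mk (QuotientGroup.mk'_surjective K) }, ?_⟩
      ext g
      obtain ⟨n, rfl⟩ := T.adm_surjective i g
      rw [Subgroup.mem_comap]
      change T.adm i n ∈ U'.toSubgroup ↔ jc (T.adm i n) ∈ V.toSubgroup.map mk
      have h1 : T.adm i n ∈ U'.toSubgroup ↔ n ∈ U''.toSubgroup := Iff.rfl
      rw [h1, hV, Subgroup.mem_comap]
      change iotaLevel X T i n ∈ V.toSubgroup ↔ j (T.adm i n) ∈ V.toSubgroup.map mk
      rw [hj_adm]
      change iotaLevel X T i n ∈ V.toSubgroup ↔ mk (iotaLevel X T i n) ∈ V.toSubgroup.map mk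
      constructor
      · intro h
        exact ⟨_, h, rfl⟩
      · rintro ⟨v, hv, hvn⟩
        rw [QuotientGroup.mk'_apply, QuotientGroup.mk'_apply, QuotientGroup.eq] at hvn
        have : iotaLevel X T i n = v * (v⁻¹ * iotaLevel X T i n) := by group
        rw [this]
        exact V.toSubgroup.mul_mem hv (hKV hvn)
  -- the induced map `Φ̄ : Q → Π̂_{𝔾_{J_i}}` agrees with the comparison isomorphism, hence is injective
  have hKΦ : K ≤ (piHatLevel X d T i).toMonoidHom.ker := closure_map_ker_adm_le_ker_piHatLevel X d T i
  let Φbar : (levelHat X T i) ⧸ K →* _ := QuotientGroup.lift K (piHatLevel X d T i).toMonoidHom hKΦ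
  have hΦbar_cont : Continuous Φbar := by
    rw [(QuotientGroup.isQuotientMap_mk K).continuous_iff]
    exact (piHatLevel X d T i).continuous
  have hΦbar_j : ∀ g, Φbar (jc g) = iotaGraph X T i g := by
    intro g
    obtain ⟨n, rfl⟩ := T.adm_surjective i g
    change Φbar (j (T.adm i n)) = _
    rw [hj_adm]
    change Φbar (mk (iotaLevel X T i n)) = _
    rw [QuotientGroup.mk'_apply, QuotientGroup.lift_mk, ← piHatLevel_iotaLevel X d T i n]
    rfl
  obtain ⟨e, he⟩ := hjc.nonempty_continuousMulEquiv hG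
  have hΦbar_eq : (Φbar : (levelHat X T i) ⧸ K → _) = e := by
    refine Continuous.ext_on hjc.denseRange hΦbar_cont e.continuous ?_
    rintro _ ⟨g, rfl⟩
    rw [hΦbar_j g]
    exact (he g).symm
  -- conclusion
  intro z hz
  rw [MonoidHom.mem_ker] at hz
  have h1 : Φbar (mk z) = 1 := by
    rw [QuotientGroup.mk'_apply, QuotientGroup.lift_mk]
    exact hz
  have h2 : e (mk z) = 1 := by rw [← congrFun hΦbar_eq (mk z)]; exact h1
  have h3 : mk z = 1 := by
    rw [← map_one e] at h2
    exact e.injective h2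
  rw [QuotientGroup.mk'_apply, QuotientGroup.eq_one_iff] at h3
  exact h3

/-- **`Ker(Ĵ_i ∩ Δ_X ↠ Π̂_{𝔾_{J_i}})` = the closure of `ι(Ker adm_i)` in `Ĵ_i ∩ Δ_X`.**
([IUTchI] Prop 2.4(i) p.50) [claim: Mochizuki2012, status: disputed] -/
theorem ker_piHatLevel_eq (i : ℕ) :
    (piHatLevel X d T i).toMonoidHom.ker =
      (((T.adm i).toMonoidHom.ker).map (iotaLevel X T i).toMonoidHom).topologicalClosure :=
  le_antisymm (ker_piHatLevel_le_closure X d T i) (closure_map_ker_adm_le_ker_piHatLevel X d T i)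

/-! ### The kernel read in `Π̂_X`; monotonicity; (INV) at the genuine datum -/

variable (Sigma SigmaHat : Set ℕ) (hsub : Sigma ⊆ SigmaHat) (hne : Set.Nonempty Sigma)
  (hprime : ∀ q ∈ SigmaHat, q.Prime)
  (S : SpecialFibreData (X.toTemperedArithmeticGroup d)) (h36 : S.Gc.Prop36Hypotheses)
  (hp : p ∉ Sigma) (TpH : Subgroup S.chart.G)
  (HatH : Subgroup (TemperedGraphGroupData.exists_completion_of_prop36 S.Gc h36 S.chart).choose)
  (hle : TpH.map (TemperedGraphGroupData.exists_completion_of_prop36 S.Gc h36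
    S.chart).choose_spec.choose.toMonoidHom ≤ HatH)
  (cuspMeetsH : {x : X.Pt // X.IsCusp x} → Prop)

/-- **`Ker(Ĵ_i ↠ Π̂_{𝔾_{J_i}})` read in `Π̂_X` is the closure of `ι(admKer_i)` in `Π_{X_K}`** ("`Ker(Δ̂_X ↠
Π̂_{𝔾*_J})`", p. 51 l. 2; = abc-iut-w4-d063's `admKerHat`, unfolded): the image under the closed embedding
`Ĵ_i ∩ Δ_X ↪ Δ_X ↪ Π_{X_K}` of `ker_piHatLevel_eq`. ([IUTchI] Prop 2.4(i) p.50) [claim: Mochizuki2012, status: disputed] -/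
theorem map_ker_pihat_eq_closure (i : ℕ) :
    (((towerOfSpecialFibreTower X d T Sigma SigmaHat hsub hne hprime S h36 hp TpH HatH hle cuspMeetsH).πhat i).ker.map ((towerOfSpecialFibreTower X d T Sigma SigmaHat hsub hne hprime S h36 hp TpH HatH hle cuspMeetsH).Jhat i).subtype : Subgroup X.PiHat) =
      (((T.admKer i).map X.DeltaTemp.subtype).map X.toHat.toMonoidHom).topologicalClosure := by
  -- the closed embedding `E : Ĵ_i ∩ Δ_X ↪ Π̂_X`
  have hΔcl : IsClosed (X.DeltaHat : Set X.PiHat) := Subgroup.isClosed_topologicalClosure _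
  have hJcl : IsClosed ((levelHat X T i : Subgroup X.DeltaHat) : Set X.DeltaHat) :=
    Subgroup.isClosed_topologicalClosure _
  have hE : IsClosedEmbedding (fun y : levelHat X T i => ((y : X.DeltaHat) : X.PiHat)) :=
    hΔcl.isClosedEmbedding_subtypeVal.comp hJcl.isClosedEmbedding_subtypeVal
  apply SetLike.coe_injective
  -- Step 1: the left-hand side is `E '' Ker(piHatLevel)`
  have h1 : ((((towerOfSpecialFibreTower X d T Sigma SigmaHat hsub hne hprime S h36 hp TpH HatH hle cuspMeetsH).πhat i).ker.map ((towerOfSpecialFibreTower X d T Sigma SigmaHat hsub hne hprime S h36 hp TpH HatH hle cuspMeetsH).Jhat i).subtype : Subgroup X.PiHat) : Set X.PiHat) =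
      (fun y : levelHat X T i => ((y : X.DeltaHat) : X.PiHat)) ''
        (((piHatLevel X d T i).toMonoidHom.ker : Subgroup (levelHat X T i)) : Set (levelHat X T i)) := by
    ext y
    constructor
    · rintro ⟨z, hz, rfl⟩
      exact ⟨⟨⟨(z : X.PiHat), levelJhat_le_deltaHat X T i z.2⟩, ((mem_levelJhat_iff X T).1 z.2).2⟩, hz, rfl⟩
    · rintro ⟨w, hw, rfl⟩
      have hy : ((w : X.DeltaHat) : X.PiHat) ∈ levelJhat X T i := ⟨(w : X.DeltaHat), w.2, rfl⟩
      have hw' : (⟨⟨((w : X.DeltaHat) : X.PiHat), levelJhat_le_deltaHat X T i hy⟩,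
          ((mem_levelJhat_iff X T).1 hy).2⟩ : levelHat X T i) = w := Subtype.ext (Subtype.ext rfl)
      have hker : piHatLevel X d T i ⟨⟨((w : X.DeltaHat) : X.PiHat), levelJhat_le_deltaHat X T i hy⟩,
          ((mem_levelJhat_iff X T).1 hy).2⟩ = 1 := by
        rw [hw']; exact hw
      exact ⟨⟨((w : X.DeltaHat) : X.PiHat), hy⟩, hker, rfl⟩
  -- Step 2: `E '' (ι_J '' Ker adm_i) = toHat '' admKer_i`
  have h2 : (fun y : levelHat X T i => ((y : X.DeltaHat) : X.PiHat)) ''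
        ((((T.adm i).toMonoidHom.ker).map (iotaLevel X T i).toMonoidHom : Subgroup (levelHat X T i)) :
          Set (levelHat X T i)) =
      ((((T.admKer i).map X.DeltaTemp.subtype).map X.toHat.toMonoidHom : Subgroup X.PiHat) : Set X.PiHat) := by
    ext y
    simp only [Set.mem_image, SetLike.mem_coe, Subgroup.mem_map]
    constructor
    · rintro ⟨w, ⟨n, hn, rfl⟩, rfl⟩
      have hn' : (n : X.DeltaTemp) ∈ T.admKer i := by
        have := hn
        rw [T.ker_adm i, Subgroup.mem_subgroupOf] at this
        exact this
      exact ⟨(n : X.DeltaTemp), ⟨n, hn', rfl⟩, rfl⟩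
    · rintro ⟨_, ⟨a, ha, rfl⟩, rfl⟩
      have ha' : (⟨a, T.admKer_le i ha⟩ : T.N i) ∈ (T.adm i).toMonoidHom.ker := by
        rw [T.ker_adm i, Subgroup.mem_subgroupOf]
        exact ha
      exact ⟨iotaLevel X T i ⟨a, T.admKer_le i ha⟩, ⟨_, ha', rfl⟩, rfl⟩
  rw [h1, ker_piHatLevel_eq X d T i, Subgroup.topologicalClosure_coe, ← hE.closure_image_eq, h2,
    Subgroup.topologicalClosure_coe]

/-- **Monotonicity of the kernels along the tower** (the input `hmono` of
`Prop24Tower.detectsTempered_of_inverseLimit`), granted that the admissible kernels are determined by the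
levels (`hNinj`; automatic when `i ↦ N_i` is injective, by `admKer_antitone`).
([IUTchI] Prop 2.4(i) p.50) [claim: Mochizuki2012, status: disputed] -/
theorem kerMono_ofSpecialFibre (hNinj : ∀ i j, T.N j ≤ T.N i → T.admKer j ≤ T.admKer i) :
    ∀ i j, (towerOfSpecialFibreTower X d T Sigma SigmaHat hsub hne hprime S h36 hp TpH HatH hle cuspMeetsH).Jhat j ≤ (towerOfSpecialFibreTower X d T Sigma SigmaHat hsub hne hprime S h36 hp TpH HatH hle cuspMeetsH).Jhat i →
      (((towerOfSpecialFibreTower X d T Sigma SigmaHat hsub hne hprime S h36 hp TpH HatH hle cuspMeetsH).πhat j).ker.map ((towerOfSpecialFibreTower X d T Sigma SigmaHat hsub hne hprime S h36 hp TpH HatH hle cuspMeetsH).Jhat j).subtype : Subgroup X.PiHat) ≤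
        ((towerOfSpecialFibreTower X d T Sigma SigmaHat hsub hne hprime S h36 hp TpH HatH hle cuspMeetsH).πhat i).ker.map ((towerOfSpecialFibreTower X d T Sigma SigmaHat hsub hne hprime S h36 hp TpH HatH hle cuspMeetsH).Jhat i).subtype := by
  intro i j hji
  rw [map_ker_pihat_eq_closure, map_ker_pihat_eq_closure]
  have hN : T.N j ≤ T.N i := (levelJhat_le_iff X d T i j).1 hji
  exact Subgroup.topologicalClosure_mono (Subgroup.map_mono (Subgroup.map_mono (hNinj i j hN)))

/-- **(INV) `DetectsTempered` at the genuine 𝔛-datum**, from the TEMPERED COMPLETENESS statement `hlim`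
("`Π^tp_X` may be written as an inverse limit of the `Π^tp_X/Ker(J ↠ Π^tp_{𝔾_J})`", p. 50 l. 40, in coset
form over the levels below any given one, with the kernels read as the closures of `ι(admKer_i)`), the
cofinality of the levels (`hcof`) and `hNinj` — by abc-iut-L5-t11's `Prop24Tower.detectsTempered_of_inverseLimit`
with every structural input discharged. ([IUTchI] Prop 2.4(i) p.50) [claim: Mochizuki2012, status: disputed] -/
theorem detectsTempered_ofSpecialFibre
    (hcof : ∀ U : Subgroup X.DeltaTemp, IsOpen (U : Set X.DeltaTemp) → U.Normal → U.FiniteIndex →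
      ∃ i, T.N i ≤ U)
    (hNinj : ∀ i j, T.N j ≤ T.N i → T.admKer j ≤ T.admKer i)
    (hlim : ∀ W : Subgroup X.PiHat, (∃ i, levelJhat X T i ≤ W) → ∀ t : ℕ → X.PiTemp,
      (∀ i j, levelJhat X T i ≤ W → levelJhat X T j ≤ levelJhat X T i →
        X.toHat ((t i)⁻¹ * t j) ∈ (((T.admKer i).map X.DeltaTemp.subtype).map
          X.toHat.toMonoidHom).topologicalClosure) →
      ∃ s : X.PiTemp, ∀ i, levelJhat X T i ≤ W →
        X.toHat (s⁻¹ * t i) ∈ (((T.admKer i).map X.DeltaTemp.subtype).map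
          X.toHat.toMonoidHom).topologicalClosure) :
    (towerOfSpecialFibreTower X d T Sigma SigmaHat hsub hne hprime S h36 hp TpH HatH hle
      cuspMeetsH).DetectsTempered := by
  haveI : T2Space X.PiHat := X.isProfiniteCompletion_toHat.t2Space
  haveI : TotallyDisconnectedSpace X.PiHat := X.isProfiniteCompletion_toHat.totallyDisconnectedSpace
  refine Prop24Tower.detectsTempered_of_inverseLimit _
    (ofSpecialFibre_deltaHatClosed X d Sigma SigmaHat hsub hne hprime S h36 hp TpH HatH hle cuspMeetsH)
    (towerOfSpecialFibreTower_levelsInDelta X d T Sigma SigmaHat hsub hne hprime S h36 hp TpH HatH hle cuspMeetsH)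
    (towerOfSpecialFibreTower_levelsOpen X d T Sigma SigmaHat hsub hne hprime S h36 hp TpH HatH hle cuspMeetsH)
    (towerOfSpecialFibreTower_levelsCofinal X d T Sigma SigmaHat hsub hne hprime S h36 hp TpH HatH hle
      cuspMeetsH hcof)
    (kerMono_ofSpecialFibre X d T Sigma SigmaHat hsub hne hprime S h36 hp TpH HatH hle cuspMeetsH hNinj) ?_
  intro W hW t ht
  have ht' : ∀ i j, levelJhat X T i ≤ W → levelJhat X T j ≤ levelJhat X T i →
      X.toHat ((t i)⁻¹ * t j) ∈ (((T.admKer i).map X.DeltaTemp.subtype).map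
        X.toHat.toMonoidHom).topologicalClosure := by
    intro i j hi hji
    have := ht i j hi hji
    rw [map_ker_pihat_eq_closure] at this
    exact this
  obtain ⟨s, hs⟩ := hlim W hW t ht'
  refine ⟨s, fun i hi => ?_⟩
  rw [map_ker_pihat_eq_closure]
  exact hs i hi

end OfSpecialFibre

end StableCurveTemperedData

end Literature.IUT.HodgeTheaters

end
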